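import Literature.AlgebraicGeometry.GroupSchemes.IdealKernelLayerMap         -- ★ (o1): `exists_layerMap`, `comp_eq_one_of_pin`
import Literature.AlgebraicGeometry.GroupSchemes.HopfIdealOfClosedSubgroup      -- ★ `quotIncl`, `ker_appTop_quotIncl`
import Literature.AlgebraicGeometry.GroupSchemes.AffineGroupSchemeSpecPoints    -- ★ `isAffine_specOver_left`
import HarnessLib

/-!
# The ideal-kernel layer map THROUGH A COVER PIN: `ψ : A → C` lands in a cover `ψ_P : A″ → C` of kernel `A″[𝔞]`, `𝔞 + 𝔭 = (1)`; the `𝔭`-layer map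
# `φ : A[𝔭] → A″[𝔭]` with `φ ≫ ι″ ≫ ψ_P = ι ≫ ψ` ([Tate 1997] (1.6)–(1.7); [Mumford 1970] §7 Thm. 4; [Conrad 2004] §7 Thm. 7.5; [Liu 2021] Prop. D.8)

Topic `Literature/AlgebraicGeometry/GroupSchemes`; namespace `Literature.AlgebraicGeometry.GroupSchemes.IdealKernelLayerMap` (continues ★ (o1)
`IdealKernelLayerMap`).  THEOREMS ONLY (no definition, no named fact, no `instance`, no notation, no `sorry`).  Cell `hodgecm-mathlib` (D-0151), FLOOR 0,
P6 «MOD programme» (crux hLiu418 = stmt-HodgeConjecture-24832, `--supports`, count-neutral): line L2 of the D-line socket `stub_DOWN`, organ `stub_SPEC`,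
piece **(ρ3-K) «K-DATA FROM THE LEG»** (LA2-plan (g2) deal 2026-09-02T07:47:05Z to LA2-p03): the reduced Hecke leg of the (ρ1𝒞) road is a homomorphism
`ψ : A_{x̄} → 𝒞_{x̄″}` into the special fibre of the SERRE-TWIST FAMILY `𝒞 = univ ⊗_𝒪 𝔭_w⁻¹`, which carries NO dock of its own; its `𝔭_{c•w}`-layer is reached
through the COVER LEG `ψ_P : A_{x̄″} → 𝒞_{x̄″}` (kernel `A_{x̄″}[𝔭_w]`, `𝔭_w + 𝔭_{c•w} = (1)`).  This file produces the layer map `φ : G₀(x̄) → G₀(x̄″)` of `ψ`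
RELATIVE TO THE COVER PIN `ι″ ≫ ψ_P`, once and generically: existence, uniqueness, homomorphism, equivariance, its kernel on all `T`-points, the
monomorphy of the cover pin, and the two letters the D-line consumes (`IsogKerLaw`: kills; D6 `QuotQuot₀Law`: the image ideal inequality).  HC_CM is proved only
modulo the printed citations (2 remaining named inputs hLiu418 24832, h413 24833) until rung 0 closes; this file is generic and changes no count.

THE MATHEMATICS ([Tate1997FiniteFlatGroupSchemes] (1.6)–(1.7) p. 122: group objects as group functors, kernels by their `T`-points; [MumfordAV1970] §7 Thm. 4
p. 72: the isogeny `ψ_P` and the homomorphisms through it; [Conrad2004GrossZagier] §7 Thm. 7.5: the Serre construction `A ⊗_𝒪 𝔞⁻¹`, its canonical isogeny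
`ψ_P : A → A ⊗ 𝔞⁻¹` with kernel `A[𝔞]` and the two-sided presentation `ψ_P ∘ g_a = a`, `g_a ∘ ψ_P = a` for `a ∈ 𝔞`; [Liu2021] Prop. D.8 (2) p. 135, p. 137: the
isogenies of the special fibres read on the `ϖ`-layers).  Work in a cartesian monoidal category `C`.  Let `A`, `C`, `A″` be monoid objects with families of
endomorphisms `α`, `α^C`, `α″ : 𝒪 → End` that are ADDITIVE and UNITAL (`α(x + y) = α(x)·α(y)` pointwise, `α(1) = 𝟙`); `𝔭 ⊆ 𝒪`; PINS `ι : G ↪ A`,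
`ι″ : G″ ↪ A″` — mono homomorphisms with `(∀ x ∈ 𝔭, t ≫ α x = 1) ↔ (∃ s, s ≫ ι = t)` — and actions-on-the-pins `β`, `β″` over `α`, `α″`.  Let
`ψ : A → C` be a homomorphism with `α x ≫ ψ = ψ ≫ α^C x` (all `x`), `ψ_P : A″ → C` a homomorphism, and `g : C → A″` an equivariant homomorphism with
`ψ_P ≫ g = α″(a)` and `g ≫ ψ_P = α^C(a)` for some `a` with `a + b = 1`, `b ∈ 𝔭` (in the application `a ∈ 𝔭_w`, `b ∈ 𝔭_{c•w}`, `g = g_a` the return map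
of the Serre cover).  KEY SCALAR FACT: a `T`-point `t` killed by `𝔭` is FIXED by `α(a)`: `t ≫ α(a) = (t ≫ α a)·(t ≫ α b) = t ≫ α(a + b) = t`; in particular
`ι ≫ α(a) = ι`, `ι″ ≫ α″(a) = ι″`.  CONSEQUENCES.  (M) The COVER PIN `ι″ ≫ ψ_P` is a MONOMORPHISM: `u ≫ ι″ ≫ ψ_P = v ≫ ι″ ≫ ψ_P` gives, after `≫ g`,
`u ≫ ι″ ≫ α″(a) = v ≫ ι″ ≫ α″(a)`, i.e. `u ≫ ι″ = v ≫ ι″`, and `ι″` is mono.  (E) Let `φ : G → G″` be the layer map of the equivariant homomorphism `ψ ≫ g`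
(★ (o1) `exists_layerMap`: `φ ≫ ι″ = ι ≫ ψ ≫ g`, a homomorphism, `β`-equivariant, unique, `j ≫ φ = 1 ↔ j ≫ ι ≫ ψ ≫ g = 1`).  Then
`φ ≫ ι″ ≫ ψ_P = ι ≫ ψ ≫ g ≫ ψ_P = ι ≫ ψ ≫ α^C(a) = ι ≫ α(a) ≫ ψ = ι ≫ ψ` — THE LAYER SQUARE THROUGH THE COVER PIN; by (M) `φ` is the UNIQUE morphism
with this square.  (K) KERNEL: `j ≫ φ = 1 ↔ j ≫ ι ≫ ψ = 1` — for `⇒`, `u := j ≫ ι ≫ ψ` is killed by `𝔭` (`ι` is, and `ψ` is equivariant) so `u ≫ α^C(a) = u`,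
while `u ≫ g = 1` gives `u ≫ α^C(a) = u ≫ g ≫ ψ_P = 1`.  (L) LETTERS: if `j ≫ ι ≫ ψ = 1` then `j ≫ φ = 1` (cancel the mono hom `ι″ ≫ ψ_P`); if `ι ≫ ψ`
factors on `T`-points through `q ≫ ι″ ≫ ψ_P` for a morphism `q : V → G″` (in the application `q = quotIncl G″ H″`, the closed subgroup `V(H″)`), then `φ`
factors through `q` (uniqueness), and — over a ring `R`, `G″` affine — `H″ ≤ ker Γ(φ)` (★ `ker_appTop_quotIncl`).

* §1 (generic, `C` cartesian monoidal) `comp_eq_self_of_add_eq_one`, `pin_comp_eq_self_of_add_eq_one` (the scalar fact), **`mono_pin_comp_cover`** (M),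
  `isMonHom_pin_comp_cover`, **`exists_layerMap_through_cover`** (E)+(K)+uniqueness, one `obtain`), **`comp_eq_one_of_layer_through_cover`** (L, kills),
  **`exists_comp_eq_of_layer_through_cover`** (L, factorisation through `q`).
* §2 (schemes over a ring `R`) **`le_ker_appTop_of_comp_quotIncl_eq`** (a factorisation through `quotIncl G I` puts `I` below `ker Γ(φ)`) and the D6 letter
  **`le_ker_appTop_of_layer_through_cover`**.

## References
* [Tate1997FiniteFlatGroupSchemes] J. Tate, *Finite flat group schemes*, in: Modular Forms and Fermat՚s Last Theorem (1997), (1.6)–(1.7) p. 122.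
* [MumfordAV1970] D. Mumford, *Abelian Varieties* (1970), §7 Thm. 4 (p. 72).
* [Conrad2004GrossZagier] B. Conrad, *Gross–Zagier revisited*, MSRI Publ. 49 (2004), §7 (Thm. 7.5).
* [Liu2021] Y. Liu, *Fourier–Jacobi cycles and arithmetic relative trace formula*, Camb. J. Math. 9 (2021), Prop. D.8 (2) p. 135, p. 137.
* [GortzWedhorn2023] U. Görtz, T. Wedhorn, *Algebraic Geometry II* (2023), (27.1.1) and §(27.2) (p. 607) (closed subschemes of affine schemes and ideals).
-/

set_option autoImplicit false

universe u

open CategoryTheory CategoryTheory.Limits MonoidalCategory CartesianMonoidalCategory AlgebraicGeometry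

noncomputable section

namespace Literature.AlgebraicGeometry.GroupSchemes.IdealKernelLayerMap

open scoped MonObj

/-! ## §1 The layer map through a cover pin (any cartesian monoidal category) -/

section Generic

variable {C : Type*} [Category C] [CartesianMonoidalCategory C]
variable {O : Type*} [CommRing O] {σ : Type*} [SetLike σ O]

/-- **THE SCALAR FACT**: for an additive unital family `αM : 𝒪 → End M` and `a + b = 1` with `b ∈ 𝔭`, every `T`-point `t` killed by `𝔭` is fixed by
`αM a`: `t ≫ αM a = (t ≫ αM a) · (t ≫ αM b) = t ≫ αM (a + b) = t`. [cite: Tate1997FiniteFlatGroupSchemes, (1.6)–(1.7) p. 122] -/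
theorem comp_eq_self_of_add_eq_one {M : C} [MonObj M] (𝔭 : σ) (αM : O → (M ⟶ M))
    (hadd : ∀ x y, αM (x + y) = αM x * αM y) (hone : αM 1 = 𝟙 M)
    {a b : O} (hab : a + b = 1) (hb : b ∈ 𝔭) {T : C} {t : T ⟶ M} (ht : ∀ x ∈ 𝔭, t ≫ αM x = 1) :
    t ≫ αM a = t :=
  calc t ≫ αM a = (t ≫ αM a) * (t ≫ αM b) := by rw [ht b hb, mul_one]
    _ = t ≫ αM (a + b) := by rw [hadd, MonObj.comp_mul]
    _ = t := by rw [hab, hone, Category.comp_id]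

/-- **THE SCALAR FACT AT A PIN**: `ιA ≫ α a = ιA` when `ιA : GA ↪ A` has the kernel-of-`𝔭` universal property, `α` is additive unital and `a + b = 1`, `b ∈ 𝔭`
(the pin is killed by `𝔭`, ★ `comp_eq_one_of_pin`). [cite: Tate1997FiniteFlatGroupSchemes, (1.6)–(1.7) p. 122] -/
theorem pin_comp_eq_self_of_add_eq_one {A GA : C} [MonObj A] (𝔭 : σ) (α : O → (A ⟶ A))
    (hadd : ∀ x y, α (x + y) = α x * α y) (hone : α 1 = 𝟙 A) (ιA : GA ⟶ A)
    (hkerA : ∀ ⦃T : C⦄ (t : T ⟶ A), (∀ x ∈ 𝔭, t ≫ α x = 1) ↔ ∃ s : T ⟶ GA, s ≫ ιA = t)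
    {a b : O} (hab : a + b = 1) (hb : b ∈ 𝔭) : ιA ≫ α a = ιA :=
  comp_eq_self_of_add_eq_one 𝔭 α hadd hone hab hb fun _ hx => comp_eq_one_of_pin 𝔭 α ιA hkerA hx

/-- **(M) THE COVER PIN `ιA″ ≫ ψP` IS A MONOMORPHISM**: a return map `g` with `ψP ≫ g = α″ a`, `a + b = 1`, `b ∈ 𝔭`, gives `u ≫ ιA″ = v ≫ ιA″` from
`u ≫ ιA″ ≫ ψP = v ≫ ιA″ ≫ ψP` (compose with `g`, `ιA″ ≫ α″ a = ιA″`), and `ιA″` is mono. [cite: Conrad2004GrossZagier, §7 (Thm. 7.5)]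
[cite: Tate1997FiniteFlatGroupSchemes, (1.6)–(1.7) p. 122] -/
theorem mono_pin_comp_cover {Cc A'' GA'' : C} [MonObj A''] (𝔭 : σ) (α'' : O → (A'' ⟶ A''))
    (h''add : ∀ x y, α'' (x + y) = α'' x * α'' y) (h''one : α'' 1 = 𝟙 A'')
    (ιA'' : GA'' ⟶ A'') [Mono ιA'']
    (hkerA'' : ∀ ⦃T : C⦄ (t : T ⟶ A''), (∀ x ∈ 𝔭, t ≫ α'' x = 1) ↔ ∃ s : T ⟶ GA'', s ≫ ιA'' = t)
    (ψP : A'' ⟶ Cc) (g : Cc ⟶ A'') {a b : O} (hab : a + b = 1) (hb : b ∈ 𝔭) (hPg : ψP ≫ g = α'' a) :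
    Mono (ιA'' ≫ ψP) where
  right_cancellation u v h := by
    have hS : ιA'' ≫ α'' a = ιA'' := pin_comp_eq_self_of_add_eq_one 𝔭 α'' h''add h''one ιA'' hkerA'' hab hb
    have h' := congrArg (· ≫ g) h
    simp only [Category.assoc, hPg, hS] at h'
    exact (cancel_mono ιA'').mp h'

/-- The cover pin `ιA″ ≫ ψP` is a homomorphism (composite of homomorphisms). [cite: Tate1997FiniteFlatGroupSchemes, (1.6)–(1.7) p. 122] -/
theorem isMonHom_pin_comp_cover {Cc A'' GA'' : C} [MonObj Cc] [MonObj A''] [MonObj GA''] (ιA'' : GA'' ⟶ A'') [IsMonHom ιA'']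
    (ψP : A'' ⟶ Cc) [IsMonHom ψP] : IsMonHom (ιA'' ≫ ψP) :=
  inferInstance

/-- **(E)+(K) THE LAYER MAP THROUGH THE COVER PIN (one `obtain`).**  Monoid objects `A`, `Cc`, `A″` with additive unital endomorphism families `α`, `αC`,
`α″`; pins `ιA : GA ↪ A`, `ιA″ : GA″ ↪ A″` (mono homomorphisms with the kernel-of-`𝔭` universal property) and actions-on-the-pins `βA`, `βA″` over `α`,
`α″`; an equivariant homomorphism `ψ : A → Cc`; a homomorphism `ψP : A″ → Cc` (the cover) and an equivariant homomorphism `g : Cc → A″` (the return map) with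
`ψP ≫ g = α″ a`, `g ≫ ψP = αC a`, where `a + b = 1`, `b ∈ 𝔭`.  THEN there is `φ : GA → GA″` with: the LAYER SQUARE `φ ≫ ιA″ ≫ ψP = ιA ≫ ψ`; `φ` a
homomorphism; `βA x ≫ φ = φ ≫ βA″ x`; KERNEL `j ≫ φ = 1 ↔ j ≫ ιA ≫ ψ = 1` on every `T`-point `j` of `GA`; and UNIQUENESS over the square.  (`φ` is the
★ (o1) layer map of `ψ ≫ g`; the square and the kernel use `ι ≫ α(a) = ι` and «`𝔭`-killed points are fixed by `α(a)`».)
[cite: Tate1997FiniteFlatGroupSchemes, (1.6)–(1.7) p. 122] [cite: MumfordAV1970, §7 Thm. 4 (p. 72)] [cite: Conrad2004GrossZagier, §7 (Thm. 7.5)]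
[cite: Liu2021, Prop. D.8 (2) p. 135, p. 137] -/
theorem exists_layerMap_through_cover {A Cc A'' GA GA'' : C} [MonObj A] [MonObj Cc] [MonObj A''] [MonObj GA] [MonObj GA'']
    (𝔭 : σ) (α : O → (A ⟶ A)) (αC : O → (Cc ⟶ Cc)) (α'' : O → (A'' ⟶ A''))
    (hαadd : ∀ x y, α (x + y) = α x * α y) (hαone : α 1 = 𝟙 A)
    (hCadd : ∀ x y, αC (x + y) = αC x * αC y) (hCone : αC 1 = 𝟙 Cc)
    (h''add : ∀ x y, α'' (x + y) = α'' x * α'' y) (h''one : α'' 1 = 𝟙 A'')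
    (ιA : GA ⟶ A) (ιA'' : GA'' ⟶ A'') [IsMonHom ιA] [IsMonHom ιA''] [Mono ιA'']
    (hkerA : ∀ ⦃T : C⦄ (t : T ⟶ A), (∀ x ∈ 𝔭, t ≫ α x = 1) ↔ ∃ s : T ⟶ GA, s ≫ ιA = t)
    (hkerA'' : ∀ ⦃T : C⦄ (t : T ⟶ A''), (∀ x ∈ 𝔭, t ≫ α'' x = 1) ↔ ∃ s : T ⟶ GA'', s ≫ ιA'' = t)
    (βA : O → (GA ⟶ GA)) (hβA : ∀ x, βA x ≫ ιA = ιA ≫ α x) (βA'' : O → (GA'' ⟶ GA'')) (hβA'' : ∀ x, βA'' x ≫ ιA'' = ιA'' ≫ α'' x)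
    (ψ : A ⟶ Cc) [IsMonHom ψ] (hψ : ∀ x, α x ≫ ψ = ψ ≫ αC x)
    (ψP : A'' ⟶ Cc) [IsMonHom ψP] (g : Cc ⟶ A'') [IsMonHom g] (hg : ∀ x, αC x ≫ g = g ≫ α'' x)
    {a b : O} (hab : a + b = 1) (hb : b ∈ 𝔭) (hPg : ψP ≫ g = α'' a) (hgP : g ≫ ψP = αC a) :
    ∃ φ : GA ⟶ GA'', φ ≫ ιA'' ≫ ψP = ιA ≫ ψ ∧ IsMonHom φ ∧ (∀ x, βA x ≫ φ = φ ≫ βA'' x) ∧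
      (∀ ⦃T : C⦄ (j : T ⟶ GA), j ≫ φ = 1 ↔ j ≫ ιA ≫ ψ = 1) ∧
      ∀ φ' : GA ⟶ GA'', φ' ≫ ιA'' ≫ ψP = ιA ≫ ψ → φ' = φ := by
  -- `ψ ≫ g` is an equivariant homomorphism `A → A″`; take its ★ (o1) layer map
  have hΨ : ∀ x, α x ≫ (ψ ≫ g) = (ψ ≫ g) ≫ α'' x := fun x => by
    rw [← Category.assoc, hψ, Category.assoc, hg, Category.assoc]
  obtain ⟨φ, hφ, hmon, hβ, hkill, huniq⟩ := exists_layerMap 𝔭 α α'' ιA ιA'' hkerA hkerA'' βA hβA βA'' hβA'' (ψ ≫ g) hΨ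
  -- the scalar facts at the two pins
  have hSA : ιA ≫ α a = ιA := pin_comp_eq_self_of_add_eq_one 𝔭 α hαadd hαone ιA hkerA hab hb
  have hSA'' : ιA'' ≫ α'' a = ιA'' := pin_comp_eq_self_of_add_eq_one 𝔭 α'' h''add h''one ιA'' hkerA'' hab hb
  -- (E) the layer square through the cover pin
  have hE : φ ≫ ιA'' ≫ ψP = ιA ≫ ψ := by
    rw [← Category.assoc, hφ, Category.assoc, Category.assoc, hgP, ← hψ a, ← Category.assoc, hSA]
  refine ⟨φ, hE, hmon, hβ, fun T j => ?_, fun φ' hφ' => ?_⟩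
  · -- (K) the kernel on `T`-points
    rw [hkill j]
    constructor
    · intro h
      -- `u := j ≫ ιA ≫ ψ` is killed by `𝔭`, hence fixed by `αC a`; and `u ≫ αC a = u ≫ g ≫ ψP = 1`
      have hu : ∀ x ∈ 𝔭, (j ≫ ιA ≫ ψ) ≫ αC x = 1 := fun x hx => by
        have h1 : ιA ≫ α x ≫ ψ = 1 := by
          rw [← Category.assoc, comp_eq_one_of_pin 𝔭 α ιA hkerA hx, MonObj.one_comp]
        rw [Category.assoc, Category.assoc, ← hψ x, h1, MonObj.comp_one]
      have h2 : (j ≫ ιA ≫ ψ) ≫ αC a = 1 := by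
        rw [← hgP, ← Category.assoc]
        have h3 : (j ≫ ιA ≫ ψ) ≫ g = j ≫ ιA ≫ ψ ≫ g := by simp only [Category.assoc]
        rw [h3, h, MonObj.one_comp]
      exact (comp_eq_self_of_add_eq_one 𝔭 αC hCadd hCone hab hb hu).symm.trans h2
    · intro h
      have h3 : j ≫ ιA ≫ ψ ≫ g = (j ≫ ιA ≫ ψ) ≫ g := by simp only [Category.assoc]
      rw [h3, h, MonObj.one_comp]
  · -- uniqueness over the square: compose with `g`
    apply huniq
    have h1 := congrArg (· ≫ g) hφ'
    simp only [Category.assoc, hPg, hSA''] at h1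
    exact h1

/-- **(L) KILLS-TRANSPORT THROUGH THE COVER PIN**: for ANY `φ` with the layer square `φ ≫ ιA″ ≫ ψP = ιA ≫ ψ`, a `T`-point `j` of `GA` with `j ≫ ιA ≫ ψ = 1`
is killed by `φ` (cancel the mono homomorphism `ιA″ ≫ ψP`).  In the application: `quotIncl (G₀ x̄) H ≫ ι₀G ≫ ψ = 1 ⟹ quotIncl (G₀ x̄) H ≫ isogW₀ = 1`, the
`IsogKerLaw` letter. [cite: Liu2021, Prop. D.8 (2) p. 135, p. 137] [cite: Tate1997FiniteFlatGroupSchemes, (1.6)–(1.7) p. 122] -/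
theorem comp_eq_one_of_layer_through_cover {A Cc A'' GA GA'' : C} [MonObj Cc] [MonObj A''] [MonObj GA''] (𝔭 : σ) (α'' : O → (A'' ⟶ A''))
    (h''add : ∀ x y, α'' (x + y) = α'' x * α'' y) (h''one : α'' 1 = 𝟙 A'')
    (ιA : GA ⟶ A) (ιA'' : GA'' ⟶ A'') [IsMonHom ιA''] [Mono ιA'']
    (hkerA'' : ∀ ⦃T : C⦄ (t : T ⟶ A''), (∀ x ∈ 𝔭, t ≫ α'' x = 1) ↔ ∃ s : T ⟶ GA'', s ≫ ιA'' = t)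
    (ψ : A ⟶ Cc) (ψP : A'' ⟶ Cc) [IsMonHom ψP] (g : Cc ⟶ A'') {a b : O} (hab : a + b = 1) (hb : b ∈ 𝔭) (hPg : ψP ≫ g = α'' a)
    {φ : GA ⟶ GA''} (hE : φ ≫ ιA'' ≫ ψP = ιA ≫ ψ) {T : C} (j : T ⟶ GA) (hj : j ≫ ιA ≫ ψ = 1) : j ≫ φ = 1 := by
  haveI : Mono (ιA'' ≫ ψP) := mono_pin_comp_cover 𝔭 α'' h''add h''one ιA'' hkerA'' ψP g hab hb hPg
  rw [← cancel_mono (ιA'' ≫ ψP), Category.assoc, hE, hj, MonObj.one_comp]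

/-- **(L) IMAGE-TRANSPORT THROUGH THE COVER PIN (factorisation form)**: for ANY `φ` with the layer square, if `ιA ≫ ψ` factors on every `T`-point through
`q ≫ ιA″ ≫ ψP` for a morphism `q : V → GA″` (in the application the closed subgroup `quotIncl (G₀ x̄″) H″ : V(H″) ↪ G₀(x̄″)`), then `φ` factors through `q`
(test at `T := GA`, `t := 𝟙`, and cancel the mono `ιA″ ≫ ψP`). [cite: Liu2021, Prop. D.8 (2) p. 135, p. 137] [cite: Tate1997FiniteFlatGroupSchemes, (1.6)–(1.7) p. 122] -/
theorem exists_comp_eq_of_layer_through_cover {A Cc A'' GA GA'' : C} [MonObj A''] (𝔭 : σ) (α'' : O → (A'' ⟶ A''))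
    (h''add : ∀ x y, α'' (x + y) = α'' x * α'' y) (h''one : α'' 1 = 𝟙 A'')
    (ιA : GA ⟶ A) (ιA'' : GA'' ⟶ A'') [Mono ιA'']
    (hkerA'' : ∀ ⦃T : C⦄ (t : T ⟶ A''), (∀ x ∈ 𝔭, t ≫ α'' x = 1) ↔ ∃ s : T ⟶ GA'', s ≫ ιA'' = t)
    (ψ : A ⟶ Cc) (ψP : A'' ⟶ Cc) (g : Cc ⟶ A'') {a b : O} (hab : a + b = 1) (hb : b ∈ 𝔭) (hPg : ψP ≫ g = α'' a)
    {φ : GA ⟶ GA''} (hE : φ ≫ ιA'' ≫ ψP = ιA ≫ ψ) {V : C} (q : V ⟶ GA'')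
    (himg : ∀ ⦃T : C⦄ (t : T ⟶ GA), ∃ s : T ⟶ V, s ≫ q ≫ ιA'' ≫ ψP = t ≫ ιA ≫ ψ) :
    ∃ s : GA ⟶ V, s ≫ q = φ := by
  haveI : Mono (ιA'' ≫ ψP) := mono_pin_comp_cover 𝔭 α'' h''add h''one ιA'' hkerA'' ψP g hab hb hPg
  obtain ⟨s, hs⟩ := himg (𝟙 GA)
  refine ⟨s, ?_⟩
  rw [← cancel_mono (ιA'' ≫ ψP), Category.assoc, hE, hs, Category.id_comp]

end Generic

/-! ## §2 Schemes over a ring: the image ideal inequality (the D6 letter `H″ ≤ ker Γ(φ)`) -/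

section Scheme

open Literature.AlgebraicGeometry.Motives (SchemeOver specOver)
open AffineGroupScheme

variable {R : Type u} [CommRing R]

-- Mathlib's `Over`/`Scheme` APIs are stated across semireducible wrappers (as in ★ `GroupSchemes/*`).
set_option backward.isDefEq.respectTransparency false in
/-- **A FACTORISATION THROUGH `quotIncl G I : Spec (Γ(G) ⧸ I) ↪ G` PUTS `I` BELOW `ker Γ(φ)`**: if `s ≫ quotIncl G I = φ` then `I ≤ ker Γ(φ)` (`Γ(φ) = Γ(s) ∘ Γ(quotIncl)` and
`ker Γ(quotIncl G I) = I`, ★ `ker_appTop_quotIncl`). [cite: GortzWedhorn2023, (27.1.1) and §(27.2) (p. 607)] -/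
theorem le_ker_appTop_of_comp_quotIncl_eq (G : SchemeOver R) [IsAffine G.left] (I : Ideal (Alg G)) {W : SchemeOver R}
    (s : W ⟶ specOver R (Alg G ⧸ I)) {φ : W ⟶ G} (h : s ≫ quotIncl G I = φ) :
    I ≤ (RingHom.ker φ.left.appTop.hom : Ideal (Alg G)) := by
  haveI : IsAffine (specOver R (Alg G ⧸ I)).left := isAffine_specOver_left (Alg G ⧸ I)
  intro x hx
  have hx' : x ∈ (RingHom.ker (quotIncl G I).left.appTop.hom : Ideal (Alg G)) := by
    rw [ker_appTop_quotIncl G I]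
    exact hx
  subst h
  rw [RingHom.mem_ker] at hx' ⊢
  rw [Over.comp_left, Scheme.Hom.comp_appTop]
  simp only [CommRingCat.hom_comp, RingHom.coe_comp, Function.comp_apply, hx', map_zero]

/-- **(L) THE D6 LETTER THROUGH THE COVER PIN**: over a ring `R`, with the target pin `GA″` affine and a closed subgroup `quotIncl GA″ H″ : V(H″) ↪ GA″` of an ideal
`H″ ≤ Γ(GA″)`: for ANY `φ` with the layer square `φ ≫ ιA″ ≫ ψP = ιA ≫ ψ`, if `ιA ≫ ψ` factors on `T`-points through `quotIncl GA″ H″ ≫ ιA″ ≫ ψP`, then `φ` factors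
through `V(H″)` AND `H″ ≤ ker Γ(φ)` — the hypothesis letter of the D-line՚s `QuotQuot₀Law`. [cite: Liu2021, Prop. D.8 (2) p. 135, p. 137]
[cite: GortzWedhorn2023, (27.1.1) and §(27.2) (p. 607)] -/
theorem le_ker_appTop_of_layer_through_cover {O : Type*} [CommRing O] {σ : Type*} [SetLike σ O]
    {A Cc A'' GA GA'' : SchemeOver R} [MonObj A''] [IsAffine GA''.left] (𝔭 : σ) (α'' : O → (A'' ⟶ A''))
    (h''add : ∀ x y, α'' (x + y) = α'' x * α'' y) (h''one : α'' 1 = 𝟙 A'')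
    (ιA : GA ⟶ A) (ιA'' : GA'' ⟶ A'') [Mono ιA'']
    (hkerA'' : ∀ ⦃T : SchemeOver R⦄ (t : T ⟶ A''), (∀ x ∈ 𝔭, t ≫ α'' x = 1) ↔ ∃ s : T ⟶ GA'', s ≫ ιA'' = t)
    (ψ : A ⟶ Cc) (ψP : A'' ⟶ Cc) (g : Cc ⟶ A'') {a b : O} (hab : a + b = 1) (hb : b ∈ 𝔭) (hPg : ψP ≫ g = α'' a)
    {φ : GA ⟶ GA''} (hE : φ ≫ ιA'' ≫ ψP = ιA ≫ ψ) (H'' : Ideal (Alg GA''))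
    (himg : ∀ ⦃T : SchemeOver R⦄ (t : T ⟶ GA), ∃ s : T ⟶ specOver R (Alg GA'' ⧸ H''), s ≫ quotIncl GA'' H'' ≫ ιA'' ≫ ψP = t ≫ ιA ≫ ψ) :
    (∃ s : GA ⟶ specOver R (Alg GA'' ⧸ H''), s ≫ quotIncl GA'' H'' = φ) ∧ H'' ≤ (RingHom.ker φ.left.appTop.hom : Ideal (Alg GA'')) := by
  obtain ⟨s, hs⟩ := exists_comp_eq_of_layer_through_cover 𝔭 α'' h''add h''one ιA ιA'' hkerA'' ψ ψP g hab hb hPg hE (quotIncl GA'' H'') himg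
  exact ⟨⟨s, hs⟩, le_ker_appTop_of_comp_quotIncl_eq GA'' H'' s hs⟩

end Scheme

end Literature.AlgebraicGeometry.GroupSchemes.IdealKernelLayerMap

end
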